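import Literature.Analysis.FluidPDE.BiotSavartCurlGradient
import Literature.Analysis.FluidPDE.BiotSavartHolderCurl
import Literature.Analysis.FluidPDE.BiotSavartIntegral
import Literature.Analysis.FluidPDE.LagrangianVelocityTimeDerivative
import Literature.Analysis.FluidPDE.HomogeneousEulerProofs
import Literature.Analysis.FluidPDE.BiotSavartGradientLp
import HarnessLib

/-!
# Route `ExtremiserTransience`, crux `NearExtremalTransiencePerFlow` (stmt-NavierStokesRegularity-26567), LINE g10-1 «two_thirds»
# (ns-idea-10 g10), stub S2 `FirstOrderIdentity`: the BIOT–SAVART GAUGE of a truncated field (identities)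

Helper file for S2 (`--supports stmt-NavierStokesRegularity-26567`).  The Euler–Lagrange test of S2 is `curl (χψ)` with
`ψ = K ∗ h` the Biot–Savart potential of a truncation `h = ζV` of the limit field.  This file collects, for an arbitrary smooth
compactly supported `h : ℝ³ → ℝ³`, the identities of that gauge out of the tree's Literature:

* `exists_holderWith_of_test` — a smooth compactly supported field is `½`-Hölder (Lipschitz and bounded);
* `contDiff_biotSavart_test`, `isDivFree_biotSavart_test` — `ψ = K ∗ h` is smooth and divergence free
  (componentwise `(K ∗ h)ᵢ = −Γ ∗ (curl h)ᵢ`, `biotSavart_apply_eq_neg_convolution_curl_apply` + `contDiff_convolution_newtonKernel`;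
  `isDivFree_biotSavart_of_contDiff`);
* `integral_fderiv_newtonKernel_apply_eq_integral_newtonKernel_mul_divergence` — `∫ DΓ(x−y)(h y) dy = ∫ Γ(x−y) div h(y) dy`
  (componentwise Gilbarg–Trudinger Lemma 4.1, `integral_newtonKernel_smul_fderiv_eq`);
* `curl_biotSavart_test` — **`curl (K ∗ h) = h − ∇(Γ ∗ div h)`** (the tree's `curl_biotSavart_eq_sub_gradient` with the
  divergence potential rewritten): the harmonic remainder of the gauge is the gradient of the Newtonian potential of `div h`;
* `divergence_smul_of_isDivFree` — for divergence-free `V`: `div (ζV) = Dζ(V)`, so for `h = ζV` the remainder's source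
  `div h = ∇ζ·V` lives where `∇ζ ≠ 0` (the far shell of the truncation).

HONEST FRAMING: potential theory of vector fields on `ℝ³`; nothing about Navier–Stokes regularity or blow-up is proved; S2,
the crux ⟨26567⟩ and NS regularity are OPEN; no summit is proved by a line. [folklore]
-/

noncomputable section

open MeasureTheory Set Filter Topology Metric
open scoped ENNReal NNReal RealInnerProductSpace ContDiff Convolution
open Literature.Analysis.FluidPDE ContinuousLinearMap

namespace Summit.NavierStokesRegularity.NavierStokesRegularity.Theorems.NearExtremalTransiencePerFlow.TwoThirds

-- the summit's namespace repeats the problem name by convention (D-0017)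
set_option linter.dupNamespace false

variable {h : EuclideanSpace ℝ (Fin 3) → EuclideanSpace ℝ (Fin 3)}

/-- A smooth (indeed `C¹`) compactly supported field is `½`-Hölder: Lipschitz (`ContDiff.lipschitzWith_of_hasCompactSupport`)
and bounded, hence Hölder of every exponent `≤ 1` (`holderWith_of_lipschitzWith_of_norm_le`). [folklore] -/
theorem exists_holderWith_of_test (hh : ContDiff ℝ 1 h) (hc : HasCompactSupport h) :
    ∃ C : ℝ≥0, HolderWith C (1 / 2 : ℝ≥0) h := by
  obtain ⟨K, hK⟩ := hh.lipschitzWith_of_hasCompactSupport hc one_ne_zero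
  obtain ⟨B, hB⟩ := hh.continuous.bounded_above_of_compact_support hc
  exact ⟨_, holderWith_of_lipschitzWith_of_norm_le (by norm_num) hK hB⟩

/-- Components of the curl of a smooth field are smooth. [folklore] -/
theorem contDiff_curl_apply_of_test (hh : ContDiff ℝ (⊤ : ℕ∞) h) (i : Fin 3) :
    ContDiff ℝ (⊤ : ℕ∞) fun x => curl h x i :=
  (EuclideanSpace.proj (𝕜 := ℝ) i).contDiff.comp (contDiff_curl (n := ⊤) hh)

/-- The Biot–Savart potential `K ∗ h` of a smooth compactly supported field is smooth and divergence free: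
componentwise `(K ∗ h)ᵢ = −Γ ∗ (curl h)ᵢ` is the Newtonian potential of a test function. [folklore] -/
theorem contDiff_biotSavart_test (hh : ContDiff ℝ (⊤ : ℕ∞) h) (hc : HasCompactSupport h) :
    ContDiff ℝ (⊤ : ℕ∞) (biotSavart h) ∧ VectorCalculus.IsDivFree (biotSavart h) := by
  have hsmooth : ContDiff ℝ (⊤ : ℕ∞) (biotSavart h) := by
    refine contDiff_euclidean.2 fun i => ?_
    have e : (fun y => biotSavart h y i) = fun y => -((fun x => curl h x i) ⋆[lsmul ℝ ℝ, volume] newtonKernel) y :=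
      funext fun y => biotSavart_apply_eq_neg_convolution_curl_apply hh hc y i
    rw [e]
    exact (contDiff_convolution_newtonKernel (contDiff_curl_apply_of_test hh i)
      ((hasCompactSupport_curl hc).comp_left (g := fun v : EuclideanSpace ℝ (Fin 3) => v i) rfl)).neg
  obtain ⟨B, hB⟩ := hh.continuous.bounded_above_of_compact_support hc
  exact ⟨hsmooth, isDivFree_biotSavart_of_contDiff hh.continuous (hh.continuous.integrable_of_hasCompactSupport hc) hB
    (hsmooth.of_le (by norm_cast))⟩


/-- `div h` of a smooth compactly supported field is continuous with compact support. [folklore] -/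
theorem continuous_divergence_of_test (hh : ContDiff ℝ 1 h) :
    Continuous (VectorCalculus.divergence h) := by
  have e : VectorCalculus.divergence h = fun x => ∑ i, ⟪EuclideanSpace.basisFun (Fin 3) ℝ i,
      fderiv ℝ h x (EuclideanSpace.basisFun (Fin 3) ℝ i)⟫ :=
    funext fun x => divergence_eq_sum_inner_fderiv (EuclideanSpace.basisFun (Fin 3) ℝ) h x
  rw [e]
  exact continuous_finsetSum _ fun i _ =>
    continuous_const.inner ((hh.continuous_fderiv one_ne_zero).clm_apply continuous_const)

/-- `div h` of a compactly supported field has compact support. [folklore] -/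
theorem hasCompactSupport_divergence (hc : HasCompactSupport h) :
    HasCompactSupport (VectorCalculus.divergence h) := by
  refine (hc.fderiv ℝ).mono fun x hx => ?_
  rw [Function.mem_support] at hx ⊢
  intro h0
  apply hx
  unfold VectorCalculus.divergence
  rw [h0]
  simp

/-- **`∫ DΓ(x−y)(h y) dy = ∫ Γ(x−y)·div h(y) dy`** for a `C¹` compactly supported field: the divergence-type potential of the
tree's `curl_biotSavart_eq_sub_gradient` is the Newtonian potential of `div h` (componentwise integration by parts,
`integral_newtonKernel_smul_fderiv_eq`). [folklore] -/
theorem integral_fderiv_newtonKernel_apply_eq_integral_newtonKernel_mul_divergence (hh : ContDiff ℝ 1 h)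
    (hc : HasCompactSupport h) (x : EuclideanSpace ℝ (Fin 3)) :
    ∫ y, fderiv ℝ newtonKernel (x - y) (h y) = ∫ y, newtonKernel (x - y) * VectorCalculus.divergence h y := by
  set b := EuclideanSpace.basisFun (Fin 3) ℝ with hb
  -- components of `h` are `C¹` with compact support
  have hhj : ∀ j : Fin 3, ContDiff ℝ 1 (fun y => h y j) := fun j =>
    (EuclideanSpace.proj (𝕜 := ℝ) j).contDiff.comp hh
  have hcj : ∀ j : Fin 3, HasCompactSupport (fun y => h y j) := fun j =>
    hc.comp_left (g := fun v : EuclideanSpace ℝ (Fin 3) => v j) rfl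
  -- left side: expand `h y = Σⱼ (h y)ⱼ eⱼ`
  have hintL : ∀ j : Fin 3, Integrable fun y => fderiv ℝ newtonKernel (x - y) (b j) • h y j :=
    fun j => integrable_fderiv_newtonKernel_smul (hhj j).continuous (hcj j) x _
  have eL : ∀ y, fderiv ℝ newtonKernel (x - y) (h y) = ∑ j : Fin 3, fderiv ℝ newtonKernel (x - y) (b j) • h y j := by
    intro y
    have hv : h y = ∑ j : Fin 3, h y j • b j := by
      simpa [hb] using ((EuclideanSpace.basisFun (Fin 3) ℝ).sum_repr (h y)).symm
    conv_lhs => rw [hv]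
    simp only [map_sum, map_smul, smul_eq_mul]
    exact Finset.sum_congr rfl fun j _ => by ring
  -- right side: `div h = Σⱼ ∂ⱼ hⱼ`
  have hintR : ∀ j : Fin 3, Integrable fun y => newtonKernel (x - y) • fderiv ℝ (fun y => h y j) y (b j) :=
    fun j => integrable_newtonKernel_smul (((hhj j).continuous_fderiv one_ne_zero).clm_apply continuous_const)
      ((hcj j).fderiv_apply (𝕜 := ℝ) (b j)) x
  have eR : ∀ y, newtonKernel (x - y) * VectorCalculus.divergence h y =
      ∑ j : Fin 3, newtonKernel (x - y) • fderiv ℝ (fun y => h y j) y (b j) := by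
    intro y
    rw [divergence_eq_sum_inner_fderiv b h y, Finset.mul_sum]
    refine Finset.sum_congr rfl fun j _ => ?_
    rw [smul_eq_mul]
    congr 1
    have hd : DifferentiableAt ℝ h y := (hh.differentiable one_ne_zero) y
    rw [fderiv_apply_comp hd j (b j), hb, EuclideanSpace.basisFun_apply, EuclideanSpace.inner_single_left]
    simp
  simp_rw [eL, eR]
  rw [integral_finsetSum _ fun j _ => hintL j, integral_finsetSum _ fun j _ => hintR j]
  refine Finset.sum_congr rfl fun j _ => ?_
  have key := integral_newtonKernel_smul_fderiv_eq (F := ℝ) (hhj j) (hcj j) x (b j)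
  rw [key]

/-- **THE CURL OF THE GAUGE: `curl (K ∗ h) = h − ∇(Γ ∗ div h)`** for a smooth compactly supported field `h`
(Majda–Bertozzi Prop. 2.16 without `div h = 0`, the tree's `curl_biotSavart_eq_sub_gradient`, with the divergence potential
written as the Newtonian potential of `div h`). [folklore] -/
theorem curl_biotSavart_test (hh : ContDiff ℝ (⊤ : ℕ∞) h) (hc : HasCompactSupport h) (x : EuclideanSpace ℝ (Fin 3)) :
    curl (biotSavart h) x =
      h x - gradient (fun x => ∫ y, newtonKernel (x - y) * VectorCalculus.divergence h y) x := by
  have hh1 : ContDiff ℝ 1 h := hh.of_le (by norm_cast)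
  obtain ⟨C, hH⟩ := exists_holderWith_of_test hh1 hc
  have e : (fun x => ∫ y, newtonKernel (x - y) * VectorCalculus.divergence h y) =
      fun x => ∫ y, fderiv ℝ newtonKernel (x - y) (h y) :=
    funext fun x => (integral_fderiv_newtonKernel_apply_eq_integral_newtonKernel_mul_divergence hh1 hc x).symm
  rw [e]
  exact curl_biotSavart_eq_sub_gradient hH (by norm_num) (by norm_num) hc x

/-- `div (ζ V) = Dζ(V)` for a divergence-free field `V` (the source of the harmonic remainder of the gauge `K ∗ (ζV)` lives where
`∇ζ ≠ 0`). [folklore] -/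
theorem divergence_smul_of_isDivFree {ζ : EuclideanSpace ℝ (Fin 3) → ℝ} {V : EuclideanSpace ℝ (Fin 3) → EuclideanSpace ℝ (Fin 3)}
    {x : EuclideanSpace ℝ (Fin 3)} (hζ : DifferentiableAt ℝ ζ x) (hV : DifferentiableAt ℝ V x)
    (hdiv : VectorCalculus.divergence V x = 0) :
    VectorCalculus.divergence (fun y => ζ y • V y) x = fderiv ℝ ζ x (V x) := by
  rw [divergence_smul_apply hζ hV, hdiv, mul_zero, zero_add, real_inner_comm, gradient, InnerProductSpace.toDual_symm_apply]

end Summit.NavierStokesRegularity.NavierStokesRegularity.Theorems.NearExtremalTransiencePerFlow.TwoThirds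

end
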